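import Summits.PneNP.PneNP.Theses.KarlinRubin
import Summits.PneNP.PneNP.Theorems.KarlinRubinMonotoneSuffices
import Summits.PneNP.PneNP.Theorems.KarlinRubinMonotoneSufficesSandwich
import Summits.PneNP.PneNP.Theorems.KarlinRubinMonotoneSufficesLocality
import Literature.Barriers.PneNP.MonotoneGapHolds
import Summits.PneNP.PneNP.Theorems.MonotoneSuffices.Negative.ORChannel
import Summits.PneNP.PneNP.Theorems.MonotoneSuffices.Negative.ORChannelCliqueInstance

/-!
# Disproof of `MonotoneSuffices` (stmt-PneNP-18026, route KarlinRubin) — findings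

Work file of the crux DISPROVER (refuter-cdisprove-stmt-PneNP-18026-0, cycle 1, 2026-08-17).
The crux `Summit.PneNP.PneNP.Theses.KarlinRubin.MonotoneSuffices` (MS):
`∀ δ ∈ (0,1/2) ∃ a ∀ s`, if SOME `B₂` family of size `≤ s n` strongly detects the planted
`⌈n^{1/2-δ}⌉`-clique in `G(n,1/2)` (type I + type II `→ 0`) then some `{∧₂,∨₂,0,1}` family of size
`≤ (s n + n)^a` does.

VERDICT OF THIS CYCLE: **no kill; the statement resists for a structural reason that is itself a
theorem in the tree.** Index of findings (all `sorry`-free unless marked):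

* §0 `not_monotoneSuffices_iff` — the negation pushed through: a kill is ONE `δ`, and for EVERY
  exponent `a` a budget `s_a` with a strongly detecting `B₂` family of size `≤ s_a` such that NO
  monotone family of size `≤ (s_a + n)^a` strongly detects.
* WHY IT RESISTS (landed by provers, cited not re-proved):
  `Summit.PneNP.PneNP.Theorems.karlinRubin_monotoneSuffices_of_quasipolyHard` — MS follows from the
  quasi-polynomial nonuniform planted-clique hypothesis; contrapositively ANY refutation of MS exhibits,
  for every `c`, strongly detecting `B₂` families with `size^c < n^⌊log₂ n⌋` infinitely often, i.e. an
  `n^{o(log n)}` planted-clique DETECTION ALGORITHM below `√n` — a breakthrough nobody has;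
  `…karlinRubin_no_detector_of_small_budget` (budgets `o(n^{1+2δ})` are vacuous),
  `…karlinRubin_monotoneSuffices_conclusion_of_largeBudget` (budgets `≥ n^{3 log n+5}` are free),
  `…karlinRubin_monotoneBlindAt_of_not_monotoneSuffices` (a kill is also an instance of the sibling
  crux `MonotoneBlind`). So the only contentful window is `n^{1+2δ} ≲ s ≲ n^{O(log n)}` and a kill
  needs BOTH a new algorithm and a new monotone lower bound.
* §1 LOAD-BEARING ANALYSIS, guard `δ < 1/2`: NOT load-bearing — for `δ ≥ 1/2` the planted set has
  `≤ 1` vertex, the planted law IS `G(n,1/2)` (`plantedCliqueDist_toOuterMeasure_of_le_one`), every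
  test has error sum `= 1` (`errSum_eq_one_of_le_one`), so the hypothesis is unsatisfiable
  (`no_strongDetector_of_half_le`) and MS with the guard dropped is EQUIVALENT to MS
  (`monotoneSufficesNoUpperGuard_iff`). Guard `0 < δ`: presumably load-bearing but UNPROVABLY so
  today — at `δ = 0` (`k = ⌈√n⌉`) polynomial `B₂` detectors exist (Alon–Krivelevich–Sudakov) while no
  polynomial monotone strong detector is known or excluded (§5, near-miss, not formalised).
* §2 LOAD-BEARING ANALYSIS, the distribution pair: MS read for FUNCTIONS ("a monotone graph function
  with `B₂` circuits of size `s` has monotone complexity `≤ (s+n)^a`") is FALSE — Tardos's gap, a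
  theorem in the tree (`Literature.Barriers.PneNP.MonotoneGap_holds`): `not_monotoneSufficesFunctionForm`.
  So any proof must use the planted pair, not monotonicity of the target alone (known to the planner;
  recorded here as a checked theorem in the crux's own quantifier shape).
* §3 LOAD-BEARING ANALYSIS, the PRODUCT NOISE ("stochastic order" is not enough) — NEW THEOREM, proved
  (LANDED under `Theorems/MonotoneSuffices/Negative/` — CubeBoundary, BlockParity, BlockParityDetector,
  BlockParityLaws, ORChannel, ORChannelCliqueInstance; restated in §3 below by name): `monotoneSuffices_false_without_productNoise : ¬ MonotoneSufficesWithoutProductNoise` — the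
  crux with its pair generalised to ANY "noise `X u` ∨ independent planted pattern `P s`" pair (the
  OR-channel / stochastic-order shape the route's rationale invokes) is FALSE, already at the level of
  Boolean FUNCTIONS: for block-parity noise (n blocks of 64^n uniform bits + one parity bit each) with one
  planted point per block, linear-size `B₂` XOR circuits detect strongly (type I `0`, type II `2^{-n}`,
  `Negative.orChannel_general_detects`) while EVERY sequence of monotone functions has error sum
  `≥ 1 - 3n/2^n → 1` (`Negative.orChannel_monotone_blind`; finite form
  `Negative.plantedLaw_le_noiseLaw_add`: `Pr_planted[f=1] - Pr_noise[f=1] ≤ 4^a(⌊√N⌋+1)/b`, by path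
  counting over first-entrance times and the edge-boundary bound `bdry² ≤ N·4^N` = total influence of a
  monotone function `≤ √N`). So what X₁ can rely on is NOT stochastic order but the PRODUCT structure of
  `G(n,1/2)` (monotone likelihood ratio ⇒ Neyman–Pearson tests monotone ⇒ monotone FUNCTIONS suffice
  trivially ⇒ the crux is purely a SIZE question); a "neighbouring OR-channel problem" (route kill
  criteria) is informative only if it keeps product noise.
* §4 NATURAL STRENGTHENINGS: exponent `a` uniform in `δ` / linear overhead — not separable from MS by
  any known bound (same window argument); not attempted.
* §5 NEAR-MISSES (docstrings only): the `δ = 0` window; the picked line `Sketch` — its stubs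
  `stub_nullMass`, `stub_plantedMass`, `stub_gglrs` are true (standard polarization facts, no attack),
  `stub_budget` is crux-strength (a kill of it = an average-case monotone lower bound under the uniform
  measure for an explicit compressed truth table; none in print); no `Targets` were served this cycle.
-/

set_option linter.dupNamespace false

namespace Summit.PneNP.PneNP.Cruxes.MonotoneSuffices.Disproof

open Filter Topology Finset
open scoped ENNReal
open Literature.Computability.Complexity Literature.Probability.RandomGraphs.PlantedClique
open Summit.PneNP.PneNP.Theses.KarlinRubin

/-! ## §0 What a kill must deliver -/

/-- **Negation pushed through.** `¬ MonotoneSuffices` is: some `δ ∈ (0,1/2)` such that for EVERY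
exponent `a` there is a budget `s` carrying a strongly detecting `B₂` family of size `≤ s n` while NO
`{∧₂,∨₂,0,1}` family of size `≤ (s n + n)^a` strongly detects. [folklore] -/
theorem not_monotoneSuffices_iff :
    ¬ MonotoneSuffices ↔
    ∃ δ : ℝ, 0 < δ ∧ δ < 1 / 2 ∧ ∀ a : ℕ, ∃ s : ℕ → ℕ,
      (∃ C : (n : ℕ) → Circuit ((⊤ : SimpleGraph (Fin n)).edgeSet),
        (∀ᶠ n : ℕ in atTop, (C n).IsOver B2 ∧ (C n).size ≤ s n) ∧
        Tendsto (fun n : ℕ => (erdosRenyiHalf n).toOuterMeasure {x | (C n).eval x = true} +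
          (plantedCliqueDist n ⌈(n : ℝ) ^ (1 / 2 - δ)⌉₊).toOuterMeasure {x | (C n).eval x = false})
          atTop (nhds 0)) ∧
      ∀ C' : (n : ℕ) → Circuit ((⊤ : SimpleGraph (Fin n)).edgeSet),
        (∀ᶠ n : ℕ in atTop, (C' n).IsOver monotoneBasis01 ∧ (C' n).size ≤ (s n + n) ^ a) →
        ¬ Tendsto (fun n : ℕ => (erdosRenyiHalf n).toOuterMeasure {x | (C' n).eval x = true} +
          (plantedCliqueDist n ⌈(n : ℝ) ^ (1 / 2 - δ)⌉₊).toOuterMeasure {x | (C' n).eval x = false})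
          atTop (nhds 0) := by
  unfold MonotoneSuffices
  push Not
  rfl

/-! ## §1 The guard `δ < 1/2` is not load-bearing (the dropped instances are vacuous) -/

/-- Planting a set with at most one vertex changes nothing. [folklore] -/
theorem plant_eq_self_of_card_le_one {n : ℕ} {S : Finset (Fin n)} (hS : S.card ≤ 1)
    (x : EdgeVec n) : plant S x = x := by
  classical
  funext e
  obtain ⟨e, he⟩ := e
  induction e using Sym2.ind with
  | _ a b =>
    have hab : a ≠ b := by simpa [SimpleGraph.mem_edgeSet] using he
    refine Summit.PneNP.PneNP.Theorems.plant_apply_of_not_inside S x ⟨s(a, b), he⟩ fun h => ?_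
    have ha := h a (Sym2.mem_mk_left a b)
    have hb := h b (Sym2.mem_mk_right a b)
    have hsub : ({a, b} : Finset (Fin n)) ⊆ S := by
      intro v hv
      simp only [Finset.mem_insert, Finset.mem_singleton] at hv
      rcases hv with rfl | rfl
      · exact ha
      · exact hb
    have := Finset.card_le_card hsub
    rw [Finset.card_pair hab] at this
    omega

/-- For `k ≤ 1` the planted-clique law is `G(n,1/2)` itself. [folklore] -/
theorem plantedCliqueDist_toOuterMeasure_of_le_one {n k : ℕ} (hk : k ≤ 1) (A : Set (EdgeVec n)) :
    (plantedCliqueDist n k).toOuterMeasure A = (erdosRenyiHalf n).toOuterMeasure A := by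
  classical
  set u := PMF.uniformOfFinset (kSubsets n k) (kSubsets_nonempty n k) with hu
  have h1 : (plantedCliqueDist n k).toOuterMeasure A =
      ∑' S, u S * (erdosRenyiHalf n).toOuterMeasure {x | plant S x ∈ A} := by
    rw [plantedCliqueDist, PMF.toOuterMeasure_map_apply, plantedCliqueJoint,
      PMF.toOuterMeasure_bind_apply]
    refine tsum_congr fun S => ?_
    rw [PMF.toOuterMeasure_map_apply]
    rfl
  have h2 : ∀ S, u S * (erdosRenyiHalf n).toOuterMeasure {x | plant S x ∈ A} =
      u S * (erdosRenyiHalf n).toOuterMeasure A := by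
    intro S
    by_cases hS : S ∈ kSubsets n k
    · have hcard : S.card ≤ 1 := by
        rw [card_of_mem_kSubsets hS]
        exact (min_le_left k n).trans hk
      have hA : {x : EdgeVec n | plant S x ∈ A} = A := by
        ext x
        simp [plant_eq_self_of_card_le_one hcard]
      rw [hA]
    · rw [hu, PMF.uniformOfFinset_apply_of_notMem (kSubsets_nonempty n k) hS, zero_mul, zero_mul]
  rw [h1]
  simp_rw [h2]
  rw [ENNReal.tsum_mul_right, PMF.tsum_coe, one_mul]

/-- For `k ≤ 1` every test has error sum exactly `1` (type I + type II of the same law). [folklore] -/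
theorem errSum_eq_one_of_le_one {n k : ℕ} (hk : k ≤ 1) (f : EdgeVec n → Bool) :
    (erdosRenyiHalf n).toOuterMeasure {x | f x = true} +
      (plantedCliqueDist n k).toOuterMeasure {x | f x = false} = 1 := by
  rw [plantedCliqueDist_toOuterMeasure_of_le_one hk]
  have hAc : {x : EdgeVec n | f x = false} = {x | f x = true}ᶜ := by
    ext x
    simp
  rw [hAc]
  exact (erdosRenyiHalf n).toOuterMeasure_add_compl _

/-- For `δ ≥ 1/2` the planted clique has at most one vertex: `⌈n^{1/2-δ}⌉ ≤ 1`. [folklore] -/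
theorem ceil_rpow_le_one_of_half_le {δ : ℝ} (hδ : 1 / 2 ≤ δ) (n : ℕ) :
    ⌈(n : ℝ) ^ (1 / 2 - δ)⌉₊ ≤ 1 := by
  have hle : (n : ℝ) ^ (1 / 2 - δ) ≤ 1 := by
    rcases Nat.eq_zero_or_pos n with hn | hn
    · subst hn
      simp only [Nat.cast_zero]
      exact Real.zero_rpow_le_one _
    · exact Real.rpow_le_one_of_one_le_of_nonpos (by exact_mod_cast hn) (by linarith)
  calc ⌈(n : ℝ) ^ (1 / 2 - δ)⌉₊ ≤ ⌈(1 : ℝ)⌉₊ := Nat.ceil_mono hle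
    _ = 1 := Nat.ceil_one

/-- **No test strongly detects a planted clique with `δ ≥ 1/2`** (the two laws coincide, the error
sum is identically `1`). Hence the instances of `MonotoneSuffices` excluded by the guard `δ < 1/2`
are vacuously TRUE, not false. [folklore] -/
theorem no_strongDetector_of_half_le {δ : ℝ} (hδ : 1 / 2 ≤ δ) (f : (n : ℕ) → EdgeVec n → Bool) :
    ¬ Tendsto (fun n : ℕ => (erdosRenyiHalf n).toOuterMeasure {x | f n x = true} +
        (plantedCliqueDist n ⌈(n : ℝ) ^ (1 / 2 - δ)⌉₊).toOuterMeasure {x | f n x = false})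
        atTop (nhds 0) := by
  intro h
  have h1 : (fun n : ℕ => (erdosRenyiHalf n).toOuterMeasure {x | f n x = true} +
      (plantedCliqueDist n ⌈(n : ℝ) ^ (1 / 2 - δ)⌉₊).toOuterMeasure {x | f n x = false}) =
      fun _ => (1 : ℝ≥0∞) :=
    funext fun n => errSum_eq_one_of_le_one (ceil_rpow_le_one_of_half_le hδ n) (f n)
  rw [h1] at h
  exact zero_ne_one (tendsto_nhds_unique tendsto_const_nhds h).symm

/-- `MonotoneSuffices` with the upper guard `δ < 1/2` DROPPED (only `0 < δ` kept). -/
def MonotoneSufficesNoUpperGuard : Prop :=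
  ∀ δ : ℝ, 0 < δ → ∃ a : ℕ, ∀ s : ℕ → ℕ,
    (∃ C : (n : ℕ) → Circuit ((⊤ : SimpleGraph (Fin n)).edgeSet),
      (∀ᶠ n : ℕ in atTop, (C n).IsOver B2 ∧ (C n).size ≤ s n) ∧
      Tendsto (fun n : ℕ => (erdosRenyiHalf n).toOuterMeasure {x | (C n).eval x = true} +
        (plantedCliqueDist n ⌈(n : ℝ) ^ (1 / 2 - δ)⌉₊).toOuterMeasure {x | (C n).eval x = false})
        atTop (nhds 0)) →
    ∃ C' : (n : ℕ) → Circuit ((⊤ : SimpleGraph (Fin n)).edgeSet),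
      (∀ᶠ n : ℕ in atTop, (C' n).IsOver monotoneBasis01 ∧ (C' n).size ≤ (s n + n) ^ a) ∧
      Tendsto (fun n : ℕ => (erdosRenyiHalf n).toOuterMeasure {x | (C' n).eval x = true} +
        (plantedCliqueDist n ⌈(n : ℝ) ^ (1 / 2 - δ)⌉₊).toOuterMeasure {x | (C' n).eval x = false})
        atTop (nhds 0)

/-- **The guard `δ < 1/2` is cosmetic**: dropping it gives an EQUIVALENT statement (at `δ ≥ 1/2`
the hypothesis is unsatisfiable by `no_strongDetector_of_half_le`). Information for provers: no case
of the crux hides at the upper end of the range. [folklore] -/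
theorem monotoneSufficesNoUpperGuard_iff : MonotoneSufficesNoUpperGuard ↔ MonotoneSuffices := by
  constructor
  · intro h δ hδ _
    exact h δ hδ
  · intro h δ hδ
    by_cases hδ' : δ < 1 / 2
    · exact h δ hδ hδ'
    · refine ⟨0, fun s hyp => ?_⟩
      obtain ⟨C, -, hT⟩ := hyp
      exact absurd hT (no_strongDetector_of_half_le (not_lt.1 hδ') fun n => (C n).eval)

/-! ## §2 The distribution pair is load-bearing: the FUNCTION form of the crux is false (Tardos) -/

/-- **`MonotoneSuffices` read for functions** (the crux with "strongly detects the planted pair"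
replaced by "computes the monotone graph function `T n`", in the SAME quantifier shape
`∃ a ∀ s, (B₂ size ≤ s n eventually) → (monotone size ≤ (s n + n)^a eventually)`; the monotone size
is the tree's `circuitSizeOver monotoneBasis`, the quantity of `Literature.Barriers.PneNP.MonotoneGap`). -/
def MonotoneSufficesFunctionForm : Prop :=
  ∀ T : (n : ℕ) → (EdgeVec n → Bool), (∀ n, Monotone (T n)) → ∃ a : ℕ, ∀ s : ℕ → ℕ,
    (∃ C : (n : ℕ) → Circuit ((⊤ : SimpleGraph (Fin n)).edgeSet),
      ∀ᶠ n : ℕ in atTop, (C n).IsOver B2 ∧ (C n).size ≤ s n ∧ (C n).Computes (T n)) →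
    ∀ᶠ n : ℕ in atTop, circuitSizeOver monotoneBasis (T n) ≤ (s n + n) ^ a

/-- **The function form is FALSE** — Tardos's `ϑ`-threshold function (`MonotoneGap_holds`, a theorem
in the tree: polynomial De Morgan circuits, monotone complexity `≥ 2^{c v^{1/8}}`) kills every
exponent `a` at the polynomial budget `s n = n^k`. So any proof of the crux must use the planted
distribution pair, not the monotonicity of the optimal test alone. [cite: Tardos1988, p. 141]
[cite: Jukna2012, Thm. 9.28] -/
theorem not_monotoneSufficesFunctionForm : ¬ MonotoneSufficesFunctionForm := by
  classical
  intro hF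
  obtain ⟨T, hTmono, ⟨k, hk⟩, ⟨c, hc, hlow⟩⟩ := Literature.Barriers.PneNP.MonotoneGap_holds
  obtain ⟨a, ha⟩ := hF T hTmono
  -- the `B₂` family supplied by the polynomial De Morgan circuits (junk elsewhere)
  let P : (n : ℕ) → Prop := fun n => ∃ C : Circuit ((⊤ : SimpleGraph (Fin n)).edgeSet),
    C.IsOver deMorganBasis ∧ C.Computes (T n) ∧ C.size ≤ n ^ k
  let C : (n : ℕ) → Circuit ((⊤ : SimpleGraph (Fin n)).edgeSet) := fun n =>
    if h : P n then h.choose else Circuit.const _ false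
  have hC : ∀ᶠ n : ℕ in atTop, (C n).IsOver B2 ∧ (C n).size ≤ n ^ k ∧ (C n).Computes (T n) := by
    filter_upwards [hk] with n hn
    have hP : P n := hn
    have hCn : C n = hP.choose := dif_pos hP
    rw [hCn]
    exact ⟨hP.choose_spec.1.mono deMorganBasis_subset_B2, hP.choose_spec.2.2,
      hP.choose_spec.2.1⟩
  have hconc := ha (fun n => n ^ k) ⟨C, hC⟩
  -- growth: `(n^k + n)^a ≤ 2^a n^{(k+1) a} < 2^{c n^{1/8}}` eventually
  have hev := Literature.Barriers.PneNP.eventually_mul_pow_lt_two_rpow ((2 : ℝ) ^ a) ((k + 1) * a) hc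
  obtain ⟨n, hn1, hcn, hlown, hevn⟩ :=
    ((eventually_ge_atTop 1).and (hconc.and (hlow.and hev))).exists
  have h2 : ((n ^ k + n) ^ a : ℕ) ≤ 2 ^ a * n ^ ((k + 1) * a) := by
    have hle : n ^ k + n ≤ 2 * n ^ (k + 1) := by
      have h1 : n ^ k ≤ n ^ (k + 1) := Nat.pow_le_pow_right hn1 (Nat.le_succ k)
      have h3 : n ≤ n ^ (k + 1) := by
        calc n = n ^ 1 := (pow_one n).symm
          _ ≤ n ^ (k + 1) := Nat.pow_le_pow_right hn1 (by omega)
      omega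
    calc (n ^ k + n) ^ a ≤ (2 * n ^ (k + 1)) ^ a := Nat.pow_le_pow_left hle a
      _ = 2 ^ a * n ^ ((k + 1) * a) := by rw [mul_pow, ← pow_mul]
  have h3 : (2 : ℝ) ^ (c * (n : ℝ) ^ (1 / 8 : ℝ)) ≤ (2 : ℝ) ^ a * (n : ℝ) ^ ((k + 1) * a) := by
    calc (2 : ℝ) ^ (c * (n : ℝ) ^ (1 / 8 : ℝ)) ≤ (circuitSizeOver monotoneBasis (T n) : ℝ) := hlown
      _ ≤ ((n ^ k + n) ^ a : ℕ) := by exact_mod_cast hcn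
      _ ≤ ((2 ^ a * n ^ ((k + 1) * a) : ℕ) : ℝ) := by exact_mod_cast h2
      _ = (2 : ℝ) ^ a * (n : ℝ) ^ ((k + 1) * a) := by push_cast; ring
  exact absurd hevn (not_lt.2 h3)


/-! ## §3 The product noise is load-bearing: "Tardos on the OR-channel" (function level)

The development is LANDED under `Summits/PneNP/PneNP/Theorems/MonotoneSuffices/Negative/`:
`CubeBoundary.lean` (edge boundary of an up-set `≤ 2^N √N`), `BlockParity.lean` (block-parity noise,
planting, path counting), `BlockParityDetector.lean` (the parity test, its exact miss probability, its
`B₂` circuit), `BlockParityLaws.lean` (the two laws, finite blindness of monotone functions),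
`ORChannel.lean` (asymptotic family; `orChannel_general_detects`, `orChannel_monotone_blind`,
`monotoneSuffices_false_without_productNoise`), and `ORChannelCliqueInstance.lean`
(`monotoneSufficesAt_iff_orChannel_cliqueInstance`: at every `δ` the crux IS the clique instance of the
same OR-channel schema). Restated here by name. -/

open Summit.PneNP.PneNP.Theorems.MonotoneSuffices.Negative in
/-- The crux at `δ` is the clique instance of the OR-channel schema (landed iff, restated): so §3's
refutation of the schema's block-parity instance removes exactly the product-noise/clique specifics of the
crux. [folklore] -/
example (δ : ℝ) := monotoneSufficesAt_iff_orChannel_cliqueInstance δ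

/-- **`MonotoneSuffices` WITHOUT the product noise** (the OR-channel form): the crux with the pair
(`G(n,1/2)`, `G(n,1/2) ∨` planted clique) generalised to an ARBITRARY pair "noise `X u`, positives
`X u ∨ P s`" with `u`, `s` independent uniform samples of finite sets (stochastically ordered, OR-channel
shape), over an arbitrary coordinate set `ι n`; same quantifier shape, bases and error functional as the
crux, size slack `+ |ι n|`. -/
def MonotoneSufficesWithoutProductNoise : Prop :=
  ∀ (ι : ℕ → Type) [∀ n, Fintype (ι n)] (U : ℕ → Type) [∀ n, Fintype (U n)] [∀ n, Nonempty (U n)]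
    (S : ℕ → Type) [∀ n, Fintype (S n)] [∀ n, Nonempty (S n)]
    (X : (n : ℕ) → U n → ι n → Bool) (P : (n : ℕ) → S n → ι n → Bool),
    ∃ a : ℕ, ∀ s : ℕ → ℕ,
      (∃ C : (n : ℕ) → Circuit (ι n),
        (∀ᶠ n : ℕ in atTop, (C n).IsOver B2 ∧ (C n).size ≤ s n) ∧
        Tendsto (fun n : ℕ =>
          ((PMF.uniformOfFintype (U n × S n)).map fun p => X n p.1).toOuterMeasure
              {x | (C n).eval x = true} +
            ((PMF.uniformOfFintype (U n × S n)).map fun p => fun c => X n p.1 c || P n p.2 c).toOuterMeasure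
              {x | (C n).eval x = false}) atTop (nhds 0)) →
      ∃ C' : (n : ℕ) → Circuit (ι n),
        (∀ᶠ n : ℕ in atTop, (C' n).IsOver monotoneBasis01 ∧
          (C' n).size ≤ (s n + Fintype.card (ι n)) ^ a) ∧
        Tendsto (fun n : ℕ =>
          ((PMF.uniformOfFintype (U n × S n)).map fun p => X n p.1).toOuterMeasure
              {x | (C' n).eval x = true} +
            ((PMF.uniformOfFintype (U n × S n)).map fun p => fun c => X n p.1 c || P n p.2 c).toOuterMeasure
              {x | (C' n).eval x = false}) atTop (nhds 0)

/-- **Any proof of the crux must use the product noise**: `MonotoneSufficesWithoutProductNoise` is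
FALSE (witness: block-parity noise, `Negative.orChannel_general_detects` /
`Negative.orChannel_monotone_blind`, landed). [folklore] -/
theorem monotoneSuffices_false_without_productNoise : ¬ MonotoneSufficesWithoutProductNoise :=
  Summit.PneNP.PneNP.Theorems.MonotoneSuffices.Negative.monotoneSuffices_false_without_productNoise

end Summit.PneNP.PneNP.Cruxes.MonotoneSuffices.Disproof
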